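import Mathlib
import HarnessLib
import Literature.ComputerArithmetic.BrisebarreHanrotMullerZimmermann2025.TableMakersDilemma

/-!
# Brisebarre–Muller: Liouville-type bounds on the hardness to round of algebraic functions

N. Brisebarre, J.-M. Muller, *Correct rounding of algebraic functions*, RAIRO Theor. Inform. Appl. 41
(2007) 71–83 [BrisebarreMuller2007] — the reference for the "algebraic functions" paragraph of the
2025 survey [BrisebarreEtAl2025, §4.3.3]. For an algebraic function the Table Maker's Dilemma has an
a-priori answer: a value `f(x)` that is not a breakpoint cannot be closer to a breakpoint than an explicit
`2^(-μ(n))`, because a certain integer is non-zero. We formalise, in radix `r = 2` and in the TMD vocabulary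
of `Literature.ComputerArithmetic.BrisebarreHanrotMullerZimmermann2025` (`scaled`, `sigRange`,
`HardnessToRoundDirLE`, `HardnessToRoundRNLE`), the two cases whose printed bounds we reproduce exactly:

* **§4, division, with numerator `a = 1` (the reciprocal `x ↦ 1/x`).** Printed: "we obtain μ(n) ≤ 2n"
  (directed roundings, §4.1) and "μ(n) ≤ 2n + 1" (rounding to nearest, §4.2), where `2^(-μ(n))` bounds
  `|a/x - y|` from below for `y` in the OUTPUT binade `(1/2, 1)`. In the scaled form of BHMZ Problems 4.1/4.2
  (`g(X) = 2^(n-1-e₂)·f(x)` with `e₂ = -1`, i.e. distances measured in units of the last place of the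
  output) this is `|g(X) - Y| > 2^(-n)` and `|g(X) - (Y + 1/2)| > 2^(-(n+1))`: `inv_hardness_dir`,
  `inv_hardness_rn`, `inv_hardnessToRoundDirLE` (μ = n), `inv_hardnessToRoundRNLE` (μ = n + 1).
* **§5.1, power functions `x ↦ x^(p/q)` with `p = 1` (the `q`-th root), input `x ∈ [2^j, 2^(j+1))`,
  `0 ≤ j < q`, output in `[1, 2)`.** Printed (§5.1.1, directed): "μ(n) ≤ max(p,q)(n−1) + (q−1)(k+1) +
  log_r(q) − min(kq + max(p−q,0)(n−1), p·j_k + max(q−p,0)(n−1))"; here `r = 2`, `p = 1`, `k = 0`, so the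
  `min` is `0` and μ(n) ≤ q(n−1) + (q−1) + log₂ q, i.e. `|y - x^(1/q)| > 1/(q·2^(qn-1))`; in scaled units
  `|g(X) - Y| ≥ 1/(q·2^((q-1)n))` — `rpow_inv_hardness_dir`. Printed (§5.1.2, nearest): the same plus
  "q·log_r 2 − log_r gcd(2^q, r^max(a−b,0))" `= q − 0`, i.e. `|g(X) - (Y + 1/2)| ≥ 1/(q·2^((q-1)n + q))` —
  `rpow_inv_hardness_rn` (no exactness hypothesis is needed there: the integer is odd). As
  `HardnessToRound…LE` statements with an integer `μ`: `μ = (q-1)n + c` resp. `(q-1)n + q + c` for any `c`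
  with `q ≤ 2^c`; instances `sqrt` (q = 2: μ = n+1 / n+3), `cbrt` (q = 3: μ = 2n+2 / 2n+5), and binary64
  `cbrt`: never 108-bad (directed) unless exact, never 111-bad (nearest) — `cbrt_binary64_dir/rn`.

The proofs follow the paper: `y^q − x = (y − x^(1/q))·Σ yⁱ (x^(1/q))^(q−1−i)` (the paper invokes the mean
value theorem, `y^q − x^(p) = q c^(q−1)(y − x^(p/q))`; the algebraic identity gives the same factor bound
`≤ q·2^(q−1)`), and `2^(q(n−1))·(y^q − x)` is a NON-ZERO INTEGER ("As we assumed y − x^(p/q) ≠ 0, … is a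
nonzero integer"), hence `≥ 1` in absolute value.

* **§5.2, negative powers, with `p = −1`, `q = 2` (the reciprocal square root `x ↦ 1/√x`), input
  `x ∈ [2^j, 2^(j+1))`, `j < 2`, output in `(1/2, 1]` (`e₂ = −1`).** Same factorisation argument
  (`y² − x⁻¹ = 2c(y − x^(−1/2))`, non-zero integer numerator); the displayed general exponent of §5.2.1 is
  not legible in our copy, so the constants are OUR instantiation, proved here: in scaled units
  `|g(X) − Y| > 2^(−(2n+1))` (directed) and `|g(X) − (Y + 1/2)| > 2^(−(2n+3))` (nearest; never a midpoint) —
  `rsqrt_hardness_dir/rn`, `rsqrt_hardnessToRoundDirLE/RNLE` (μ = 2n+1 / 2n+3), binary64: `rsqrt_binary64`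
  (never 107-bad directed unless exact, never 109-bad nearest).

* **All input binades.** The exponent periodicity (`x ↦ 2^(qk)·x` for the `q`-th root, `x ↦ 4^k·x` for
  `1/√x`) leaves the scaled function unchanged (`scaled_rpow_inv_periodic`, `scaled_rsqrt_periodic`,
  transported by `hardnessToRoundDirLE_congr` / `hardnessToRoundRNLE_congr`), so the statements hold on
  EVERY input binade `e` with output binade `⌊e/q⌋` resp. `−1 − ⌊e/2⌋`: `rpow_inv_hardnessToRound…_all`,
  `rsqrt_hardnessToRound…_all`, binary64 `cbrt_binary64_all` (108 / 111), `rsqrt_binary64_all` (107 / 109).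

NOT here (TODO(general form)): general radix `r`, powers `x^(p/q)` with `|p| ≠ 1` (§5.1 with `k > 0`,
§5.2 with `p < −1`), division by a general floating-point `a` (§4), and the Diophantine
Problems 3–6 (which ask for the true minima). The survey's display "htr ⩽ (q−1)·n + …" [BrisebarreEtAl2025,
§4.3.3] is the directed-rounding bound above.
-/

namespace Literature.ComputerArithmetic.BrisebarreMuller2007

open Finset
open Literature.ComputerArithmetic.BrisebarreHanrotMullerZimmermann2025

/-! ### The core inequality of §5.1: a non-zero integer numerator forces a gap -/

/-- Core of [BrisebarreMuller2007, §5.1] for `p = 1`, radix 2: if `1 ≤ x < 2^q`, `1 ≤ y ≤ 2`, and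
`y^q − x = N/D` with `N` a NON-ZERO integer and `D > 0`, then `|y − x^(1/q)| ≥ 1/(D·q·2^(q−1))`
(since `y^q − x = (y − x^(1/q))·Σ_{i<q} yⁱ x^((q−1−i)/q)` and the sum is at most `q·2^(q−1)`).
[cite: BrisebarreMuller2007, §5.1.1 eq. (2)] -/
theorem abs_sub_rpow_inv_ge_of_ne_zero {q : ℕ} (hq : 1 ≤ q) {x y D : ℝ} {N : ℤ}
    (hx1 : 1 ≤ x) (hxq : x < 2 ^ q) (hy1 : 1 ≤ y) (hy2 : y ≤ 2) (hD : 0 < D) (hN : N ≠ 0)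
    (hyx : y ^ q - x = N / D) :
    1 / (D * (q * 2 ^ (q - 1))) ≤ |y - x ^ ((q : ℝ)⁻¹)| := by
  have hq0 : q ≠ 0 := by omega
  have hx0 : 0 ≤ x := by linarith
  set t : ℝ := x ^ ((q : ℝ)⁻¹) with ht
  have ht0 : 0 ≤ t := Real.rpow_nonneg hx0 _
  have ht1 : 1 ≤ t := Real.one_le_rpow hx1 (by positivity)
  have ht2 : t ≤ 2 := by
    have h := Real.rpow_lt_rpow hx0 hxq (inv_pos.2 (by exact_mod_cast (show 0 < q by omega)) :
      (0 : ℝ) < ((q : ℝ)⁻¹))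
    rw [Real.pow_rpow_inv_natCast (by norm_num) hq0] at h
    exact h.le
  have htq : t ^ q = x := Real.rpow_inv_natCast_pow hx0 hq0
  -- the factor S = Σ yⁱ t^(q-1-i)
  set S : ℝ := ∑ i ∈ range q, y ^ i * t ^ (q - 1 - i) with hS
  have hSid : S * (y - t) = y ^ q - x := by rw [hS, geom_sum₂_mul, htq]
  have hSle : S ≤ q * 2 ^ (q - 1) := by
    have hterm : ∀ i ∈ range q, y ^ i * t ^ (q - 1 - i) ≤ (2 : ℝ) ^ (q - 1) := by
      intro i hi
      have hi' : i < q := mem_range.1 hi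
      have e : (2 : ℝ) ^ (q - 1) = 2 ^ i * 2 ^ (q - 1 - i) := by
        rw [← pow_add]; congr 1; omega
      rw [e]
      exact mul_le_mul (pow_le_pow_left₀ (by linarith) hy2 i)
        (pow_le_pow_left₀ ht0 ht2 _) (pow_nonneg ht0 _) (pow_nonneg (by norm_num) i)
    calc S ≤ ∑ _i ∈ range q, (2 : ℝ) ^ (q - 1) := sum_le_sum hterm
      _ = q * 2 ^ (q - 1) := by rw [sum_const, card_range, nsmul_eq_mul]
  have hSge : (1 : ℝ) ≤ S := by
    have hterm : ∀ i ∈ range q, (1 : ℝ) ≤ y ^ i * t ^ (q - 1 - i) := by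
      intro i _
      have h1 : (1 : ℝ) ≤ y ^ i := one_le_pow₀ hy1
      have h2 : (1 : ℝ) ≤ t ^ (q - 1 - i) := one_le_pow₀ ht1
      nlinarith
    calc (1 : ℝ) ≤ q := by exact_mod_cast hq
      _ = ∑ _i ∈ range q, (1 : ℝ) := by rw [sum_const, card_range, nsmul_eq_mul, mul_one]
      _ ≤ S := sum_le_sum hterm
  have hSpos : 0 < S := lt_of_lt_of_le one_pos hSge
  -- |y^q - x| ≥ 1/D
  have hnum : 1 / D ≤ |y ^ q - x| := by
    rw [hyx, abs_div, abs_of_pos hD]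
    have : (1 : ℝ) ≤ |(N : ℝ)| := by
      rw [← Int.cast_abs]; exact_mod_cast Int.one_le_abs hN
    exact div_le_div_of_nonneg_right this hD.le
  -- conclude
  have hkey : |y - t| = |y ^ q - x| / S := by
    rw [← hSid, abs_mul, abs_of_pos hSpos]; field_simp
  rw [hkey, le_div_iff₀ hSpos]
  calc 1 / (D * (q * 2 ^ (q - 1))) * S ≤ 1 / (D * (q * 2 ^ (q - 1))) * (q * 2 ^ (q - 1)) :=
        mul_le_mul_of_nonneg_left hSle (by positivity)
    _ = 1 / D := by field_simp
    _ ≤ |y ^ q - x| := hnum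

/-! ### §5.1 with `p = 1`: the `q`-th root on `[2^j, 2^(j+1))`, `j < q`, output binade `[1, 2)` -/

section Root

variable {q n j : ℕ}

/-- The input of significand `X` in the binade `[2^j, 2^(j+1))` lies in `[1, 2^q)` when `j < q`, and the
scaled `q`-th root is `2^(n-1)·x^(1/q)`. [cite: BrisebarreMuller2007, §5.1] -/
private theorem root_setup (hn : 1 ≤ n) (hj : j < q) {X : ℤ} (hX : X ∈ sigRange n) :
    let x : ℝ := (X : ℝ) * (2 : ℝ) ^ ((j : ℤ) - (n : ℤ) + 1)
    1 ≤ x ∧ x < 2 ^ q ∧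
      scaled (fun x : ℝ => x ^ ((q : ℝ)⁻¹)) n j 0 X = (2 : ℝ) ^ (n - 1) * x ^ ((q : ℝ)⁻¹) ∧
      x = (X : ℝ) * 2 ^ j / 2 ^ (n - 1) := by
  intro x
  simp only [sigRange, Set.mem_Icc] at hX
  obtain ⟨hXl, hXu⟩ := hX
  obtain ⟨m, rfl⟩ : ∃ m, n = m + 1 := ⟨n - 1, by omega⟩
  simp only [Nat.add_sub_cancel]
  have hXl' : (2 : ℝ) ^ m ≤ X := by
    have : ((2 ^ (m + 1 - 1) : ℤ) : ℝ) ≤ X := by exact_mod_cast hXl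
    simpa using this
  have hXu' : (X : ℝ) < 2 ^ (m + 1) := by
    have : (X : ℝ) ≤ ((2 ^ (m + 1) - 1 : ℤ) : ℝ) := by exact_mod_cast hXu
    push_cast at this; linarith
  have ex : x = (X : ℝ) * 2 ^ j / 2 ^ m := by
    show (X : ℝ) * (2 : ℝ) ^ ((j : ℤ) - ((m + 1 : ℕ) : ℤ) + 1) = _
    have : ((j : ℤ) - ((m + 1 : ℕ) : ℤ) + 1) = (j : ℤ) - (m : ℤ) := by push_cast; ring
    rw [this, zpow_sub₀ (by norm_num), zpow_natCast, zpow_natCast, mul_div_assoc]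
  refine ⟨?_, ?_, ?_, ex⟩
  · rw [ex, le_div_iff₀ (by positivity), one_mul]
    calc (2 : ℝ) ^ m ≤ X := hXl'
      _ = X * 2 ^ 0 := by simp
      _ ≤ X * 2 ^ j := by
        exact mul_le_mul_of_nonneg_left (pow_le_pow_right₀ (by norm_num) (Nat.zero_le j))
          (by linarith [pow_pos (show (0:ℝ) < 2 by norm_num) m])
  · rw [ex, div_lt_iff₀ (by positivity)]
    calc (X : ℝ) * 2 ^ j < 2 ^ (m + 1) * 2 ^ j := by
          exact mul_lt_mul_of_pos_right hXu' (by positivity)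
      _ = 2 ^ (j + 1) * 2 ^ m := by rw [← pow_add, ← pow_add]; congr 1; omega
      _ ≤ 2 ^ q * 2 ^ m := by
          exact mul_le_mul_of_nonneg_right (pow_le_pow_right₀ (by norm_num) (by omega))
            (by positivity)
  · rw [scaled_def]
    have : ((m + 1 : ℕ) : ℤ) - 1 - 0 = (m : ℤ) := by push_cast; ring
    rw [this, zpow_natCast]

/-- **[BrisebarreMuller2007, §5.1.1] for the `q`-th root, radix 2, directed roundings.** For a precision-`n`
input `x = X·2^(j−n+1) ∈ [2^j, 2^(j+1))`, `0 ≤ j < q`, and any `Y ∈ ⟦2^(n−1), 2^n⟧` with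
`2^(n−1)·x^(1/q) ≠ Y`: `|2^(n−1)·x^(1/q) − Y| ≥ 1/(q·2^((q−1)n))`. This is the printed bound
"μ(n) ≤ max(p,q)(n−1) + (q−1)(k+1) + log_r(q) − min(…)" with `r = 2`, `p = 1`, `k = 0` (so `min(…) = 0`),
i.e. `|y − x^(1/q)| > 1/(q·2^(qn−1))` for `y = Y/2^(n−1)`, rewritten in units of the output's last place.
[cite: BrisebarreMuller2007, §5.1.1] -/
theorem rpow_inv_hardness_dir (hq : 1 ≤ q) (hn : 1 ≤ n) (hj : j < q) {X Y : ℤ}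
    (hX : X ∈ sigRange n) (hY : Y ∈ Set.Icc (2 ^ (n - 1) : ℤ) (2 ^ n))
    (hne : scaled (fun x : ℝ => x ^ ((q : ℝ)⁻¹)) n j 0 X ≠ Y) :
    1 / ((q : ℝ) * 2 ^ ((q - 1) * n)) ≤ |scaled (fun x : ℝ => x ^ ((q : ℝ)⁻¹)) n j 0 X - Y| := by
  obtain ⟨hx1, hxq, hsc, hx⟩ := root_setup (q := q) hn hj hX
  set x : ℝ := (X : ℝ) * (2 : ℝ) ^ ((j : ℤ) - (n : ℤ) + 1)
  rw [hsc] at hne ⊢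
  obtain ⟨hYl, hYu⟩ := hY
  obtain ⟨m, rfl⟩ : ∃ m, n = m + 1 := ⟨n - 1, by omega⟩
  obtain ⟨q', rfl⟩ : ∃ q', q = q' + 1 := ⟨q - 1, by omega⟩
  simp only [Nat.add_sub_cancel] at hx hne hYl ⊢
  have hq0 : q' + 1 ≠ 0 := by omega
  have hx0 : 0 ≤ x := by linarith
  -- y = Y / 2^m ∈ [1, 2]
  set y : ℝ := (Y : ℝ) / 2 ^ m with hy
  have h2m : (0 : ℝ) < 2 ^ m := by positivity
  have hYl' : (2 : ℝ) ^ m ≤ Y := by exact_mod_cast hYl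
  have hYu' : (Y : ℝ) ≤ 2 ^ (m + 1) := by exact_mod_cast hYu
  have hy1 : 1 ≤ y := by rw [hy, le_div_iff₀ h2m]; linarith
  have hy2 : y ≤ 2 := by rw [hy, div_le_iff₀ h2m, ← pow_succ']; exact hYu'
  -- y^q - x = N / 2^(q m), N an integer
  set N : ℤ := Y ^ (q' + 1) - X * 2 ^ (j + q' * m) with hN
  have hpow : (2 : ℝ) ^ ((q' + 1) * m) = 2 ^ (q' * m) * 2 ^ m := by rw [← pow_add]; congr 1; ring
  have hyx : y ^ (q' + 1) - x = (N : ℝ) / 2 ^ ((q' + 1) * m) := by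
    rw [hN, hy, hx, div_pow, ← pow_mul, hpow]
    push_cast
    field_simp
    ring
  have hNne : N ≠ 0 := by
    intro h0
    have hyq : y ^ (q' + 1) = x := by
      have := hyx; rw [h0, Int.cast_zero, zero_div, sub_eq_zero] at this; exact this
    have hyt : y = x ^ (((q' + 1 : ℕ) : ℝ)⁻¹) := by
      have htq : (x ^ (((q' + 1 : ℕ) : ℝ)⁻¹)) ^ (q' + 1) = x := Real.rpow_inv_natCast_pow hx0 hq0
      exact (pow_left_inj₀ (by linarith) (Real.rpow_nonneg hx0 _) hq0).1 (hyq.trans htq.symm)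
    apply hne
    rw [← hyt, hy]; exact mul_div_cancel₀ _ h2m.ne'
  have hcore := abs_sub_rpow_inv_ge_of_ne_zero (q := q' + 1) (by omega) hx1 hxq hy1 hy2
    (by positivity) hNne hyx
  simp only [Nat.add_sub_cancel] at hcore
  -- |2^m t - Y| = 2^m |y - t|
  have hyY : (Y : ℝ) = y * 2 ^ m := (div_eq_iff h2m.ne').1 hy.symm
  have habs : |(2 : ℝ) ^ m * x ^ (((q' + 1 : ℕ) : ℝ)⁻¹) - Y| = 2 ^ m * |y - x ^ (((q' + 1 : ℕ) : ℝ)⁻¹)| := by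
    rw [hyY, show (2 : ℝ) ^ m * x ^ (((q' + 1 : ℕ) : ℝ)⁻¹) - y * 2 ^ m
        = -(2 ^ m * (y - x ^ (((q' + 1 : ℕ) : ℝ)⁻¹))) by ring, abs_neg, abs_mul, abs_of_pos h2m]
  rw [habs]
  have hpow2 : (2 : ℝ) ^ (q' * (m + 1)) = 2 ^ (q' * m) * 2 ^ q' := by rw [← pow_add, mul_add_one]
  calc 1 / (((q' + 1 : ℕ) : ℝ) * 2 ^ (q' * (m + 1)))
      = 2 ^ m * (1 / (2 ^ ((q' + 1) * m) * (((q' + 1 : ℕ) : ℝ) * 2 ^ q'))) := by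
        rw [hpow, hpow2]; field_simp
    _ ≤ 2 ^ m * |y - x ^ (((q' + 1 : ℕ) : ℝ)⁻¹)| := mul_le_mul_of_nonneg_left hcore h2m.le

/-- **[BrisebarreMuller2007, §5.1.2] for the `q`-th root, radix 2, rounding to nearest.** For a precision-`n`
input `x ∈ [2^j, 2^(j+1))`, `0 ≤ j < q`, and any `Y ∈ ⟦2^(n−1), 2^n − 1⟧`:
`|2^(n−1)·x^(1/q) − (Y + 1/2)| ≥ 1/(q·2^((q−1)n + q))` — the printed "μ(n) ≤ max(p,q)(n−1) + (q−1)(k+1)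
+ log_r(q) + q·log_r(2) − min(a,b) − log_r gcd(2^q, r^max(a−b,0))" with `r = 2`, `p = 1`, `k = 0`,
`a = 0 ≤ b`. No exactness hypothesis: the integer `(2Y+1)^q − X·2^(j+1+(q−1)n)` is odd, so a `q`-th root
of a floating-point number is never a midpoint. [cite: BrisebarreMuller2007, §5.1.2] -/
theorem rpow_inv_hardness_rn (hq : 1 ≤ q) (hn : 1 ≤ n) (hj : j < q) {X Y : ℤ}
    (hX : X ∈ sigRange n) (hY : Y ∈ Set.Icc (2 ^ (n - 1) : ℤ) (2 ^ n - 1)) :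
    1 / ((q : ℝ) * 2 ^ ((q - 1) * n + q))
      ≤ |scaled (fun x : ℝ => x ^ ((q : ℝ)⁻¹)) n j 0 X - (Y + 1 / 2)| := by
  obtain ⟨hx1, hxq, hsc, hx⟩ := root_setup (q := q) hn hj hX
  set x : ℝ := (X : ℝ) * (2 : ℝ) ^ ((j : ℤ) - (n : ℤ) + 1)
  rw [hsc]
  obtain ⟨hYl, hYu⟩ := hY
  obtain ⟨m, rfl⟩ : ∃ m, n = m + 1 := ⟨n - 1, by omega⟩
  obtain ⟨q', rfl⟩ : ∃ q', q = q' + 1 := ⟨q - 1, by omega⟩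
  simp only [Nat.add_sub_cancel] at hx hYl ⊢
  have hx0 : 0 ≤ x := by linarith
  -- y = (2Y+1) / 2^(m+1) ∈ [1, 2]
  set y : ℝ := (2 * (Y : ℝ) + 1) / 2 ^ (m + 1) with hy
  have h2m : (0 : ℝ) < 2 ^ (m + 1) := by positivity
  have hYl' : (2 : ℝ) ^ m ≤ Y := by exact_mod_cast hYl
  have hYu' : (Y : ℝ) ≤ 2 ^ (m + 1) - 1 := by exact_mod_cast hYu
  have hy1 : 1 ≤ y := by rw [hy, le_div_iff₀ h2m, pow_succ]; linarith
  have hy2 : y ≤ 2 := by rw [hy, div_le_iff₀ h2m]; linarith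
  -- y^q - x = N / 2^(q (m+1)), N an ODD integer
  set N : ℤ := (2 * Y + 1) ^ (q' + 1) - X * 2 ^ (j + 1 + q' * (m + 1)) with hN
  have hpow : (2 : ℝ) ^ ((q' + 1) * (m + 1)) = 2 ^ (q' * (m + 1)) * 2 ^ (m + 1) := by
    rw [← pow_add]; congr 1; ring
  have hyx : y ^ (q' + 1) - x = (N : ℝ) / 2 ^ ((q' + 1) * (m + 1)) := by
    rw [hN, hy, hx, div_pow, ← pow_mul, hpow]
    push_cast
    field_simp
    ring
  have hNodd : Odd N := by
    rw [hN]
    refine Odd.sub_even (Odd.pow ⟨Y, by ring⟩) ⟨X * 2 ^ (j + q' * (m + 1)), ?_⟩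
    ring
  have hNne : N ≠ 0 := by rintro h0; rw [h0] at hNodd; exact (Int.not_even_iff_odd.2 hNodd) ⟨0, rfl⟩
  have hcore := abs_sub_rpow_inv_ge_of_ne_zero (q := q' + 1) (by omega) hx1 hxq hy1 hy2
    (by positivity) hNne hyx
  simp only [Nat.add_sub_cancel] at hcore
  have h2m' : (0 : ℝ) < 2 ^ m := by positivity
  have hyY : 2 * (Y : ℝ) + 1 = y * 2 ^ (m + 1) := (div_eq_iff h2m.ne').1 hy.symm
  have habs : |(2 : ℝ) ^ m * x ^ (((q' + 1 : ℕ) : ℝ)⁻¹) - (Y + 1 / 2)|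
      = 2 ^ m * |y - x ^ (((q' + 1 : ℕ) : ℝ)⁻¹)| := by
    rw [show (2 : ℝ) ^ m * x ^ (((q' + 1 : ℕ) : ℝ)⁻¹) - (Y + 1 / 2)
        = -(2 ^ m * (y - x ^ (((q' + 1 : ℕ) : ℝ)⁻¹))) by linear_combination (-(1 / 2) : ℝ) * hyY,
      abs_neg, abs_mul, abs_of_pos h2m']
  rw [habs]
  have hpow2 : (2 : ℝ) ^ (q' * (m + 1) + (q' + 1)) = 2 ^ (q' * (m + 1)) * 2 ^ q' * 2 := by
    rw [pow_add, pow_succ, mul_assoc]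
  calc 1 / (((q' + 1 : ℕ) : ℝ) * 2 ^ (q' * (m + 1) + (q' + 1)))
      = 2 ^ m * (1 / (2 ^ ((q' + 1) * (m + 1)) * (((q' + 1 : ℕ) : ℝ) * 2 ^ q'))) := by
        rw [hpow, hpow2, pow_succ]; field_simp
    _ ≤ 2 ^ m * |y - x ^ (((q' + 1 : ℕ) : ℝ)⁻¹)| := mul_le_mul_of_nonneg_left hcore h2m'.le

/-- The directed-rounding bound as a `HardnessToRoundDirLE` statement (BHMZ Problem 4.1 form): on each
input binade `[2^j, 2^(j+1))`, `j < q`, the hardness to round of `x ↦ x^(1/q)` in precision `n` is at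
most `(q−1)·n + c` for any `c` with `q ≤ 2^c`. [cite: BrisebarreMuller2007, §5.1.1] -/
theorem rpow_inv_hardnessToRoundDirLE (hq : 1 ≤ q) (hn : 1 ≤ n) (hj : j < q) {c : ℕ} (hc : q ≤ 2 ^ c) :
    HardnessToRoundDirLE (fun x : ℝ => x ^ ((q : ℝ)⁻¹)) n j 0 (((q - 1) * n + c : ℕ) : ℤ) := by
  intro X hX hexact Y hY
  have hne : scaled (fun x : ℝ => x ^ ((q : ℝ)⁻¹)) n j 0 X ≠ Y := fun h => hexact ⟨Y, h⟩
  refine le_trans ?_ (rpow_inv_hardness_dir hq hn hj hX hY hne)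
  rw [zpow_neg, zpow_natCast, pow_add, one_div]
  have hc' : (q : ℝ) ≤ 2 ^ c := by exact_mod_cast hc
  have hqpos : (0 : ℝ) < q := by exact_mod_cast (show 0 < q by omega)
  exact inv_anti₀ (by positivity) (by rw [mul_comm]; exact mul_le_mul_of_nonneg_left hc' (by positivity))

/-- The round-to-nearest bound as a `HardnessToRoundRNLE` statement (BHMZ Problem 4.2 form):
`μ = (q−1)·n + q + c` for any `c` with `q ≤ 2^c`. [cite: BrisebarreMuller2007, §5.1.2] -/
theorem rpow_inv_hardnessToRoundRNLE (hq : 1 ≤ q) (hn : 1 ≤ n) (hj : j < q) {c : ℕ} (hc : q ≤ 2 ^ c) :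
    HardnessToRoundRNLE (fun x : ℝ => x ^ ((q : ℝ)⁻¹)) n j 0 (((q - 1) * n + q + c : ℕ) : ℤ) := by
  intro X hX _ Y hY
  refine le_trans ?_ (rpow_inv_hardness_rn hq hn hj hX hY)
  rw [zpow_neg, zpow_natCast, pow_add, one_div]
  have hc' : (q : ℝ) ≤ 2 ^ c := by exact_mod_cast hc
  have hqpos : (0 : ℝ) < q := by exact_mod_cast (show 0 < q by omega)
  exact inv_anti₀ (by positivity) (by rw [mul_comm]; exact mul_le_mul_of_nonneg_left hc' (by positivity))

/-- Square root (`q = 2`), directed roundings: hardness to round `≤ n + 1` on `[1,2)` and `[2,4)`.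
[cite: BrisebarreMuller2007, §5.1.1] -/
theorem sqrt_hardnessToRoundDirLE (hn : 1 ≤ n) (hj : j < 2) :
    HardnessToRoundDirLE Real.sqrt n j 0 ((n + 1 : ℕ) : ℤ) := by
  have h := rpow_inv_hardnessToRoundDirLE (q := 2) (by norm_num) hn hj (c := 1) (by norm_num)
  have e : (fun x : ℝ => x ^ (((2 : ℕ) : ℝ)⁻¹)) = Real.sqrt := by
    funext x; rw [Real.sqrt_eq_rpow]; norm_num
  rw [e, show (2 - 1) * n + 1 = n + 1 by omega] at h
  exact h

/-- Square root, rounding to nearest: hardness to round `≤ n + 3`. [cite: BrisebarreMuller2007, §5.1.2] -/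
theorem sqrt_hardnessToRoundRNLE (hn : 1 ≤ n) (hj : j < 2) :
    HardnessToRoundRNLE Real.sqrt n j 0 ((n + 3 : ℕ) : ℤ) := by
  have h := rpow_inv_hardnessToRoundRNLE (q := 2) (by norm_num) hn hj (c := 1) (by norm_num)
  have e : (fun x : ℝ => x ^ (((2 : ℕ) : ℝ)⁻¹)) = Real.sqrt := by
    funext x; rw [Real.sqrt_eq_rpow]; norm_num
  rw [e, show (2 - 1) * n + 2 + 1 = n + 3 by omega] at h
  exact h

/-- Cube root (`q = 3`), directed roundings: hardness to round `≤ 2n + 2` on each of `[1,2)`, `[2,4)`,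
`[4,8)`. [cite: BrisebarreMuller2007, §5.1.1] -/
theorem cbrt_hardnessToRoundDirLE (hn : 1 ≤ n) (hj : j < 3) :
    HardnessToRoundDirLE (fun x : ℝ => x ^ ((3 : ℝ)⁻¹)) n j 0 ((2 * n + 2 : ℕ) : ℤ) := by
  have h := rpow_inv_hardnessToRoundDirLE (q := 3) (by norm_num) hn hj (c := 2) (by norm_num)
  have e3 : (3 - 1) * n + 2 = 2 * n + 2 := by omega
  simpa [e3] using h

/-- Cube root, rounding to nearest: hardness to round `≤ 2n + 5`. [cite: BrisebarreMuller2007, §5.1.2] -/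
theorem cbrt_hardnessToRoundRNLE (hn : 1 ≤ n) (hj : j < 3) :
    HardnessToRoundRNLE (fun x : ℝ => x ^ ((3 : ℝ)⁻¹)) n j 0 ((2 * n + 5 : ℕ) : ℤ) := by
  have h := rpow_inv_hardnessToRoundRNLE (q := 3) (by norm_num) hn hj (c := 2) (by norm_num)
  have e3 : (3 - 1) * n + 3 + 2 = 2 * n + 5 := by omega
  simpa [e3] using h

/-- binary64 cube root, directed roundings: on every input binade (`j = e mod 3`), a non-exact `cbrt(x)` is
never within `2^(-108)` (in units of the last place) of a floating-point number — `cbrt` has no 108-bad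
case. [cite: BrisebarreMuller2007, §5.1.1] -/
theorem cbrt_binary64_dir (hj : j < 3) : HardnessToRoundDirLE (fun x : ℝ => x ^ ((3 : ℝ)⁻¹)) 53 j 0 108 :=
  cbrt_hardnessToRoundDirLE (n := 53) (by norm_num) hj

/-- binary64 cube root, rounding to nearest: no 111-bad case (and no midpoint at all).
[cite: BrisebarreMuller2007, §5.1.2] -/
theorem cbrt_binary64_rn (hj : j < 3) : HardnessToRoundRNLE (fun x : ℝ => x ^ ((3 : ℝ)⁻¹)) 53 j 0 111 :=
  cbrt_hardnessToRoundRNLE (n := 53) (by norm_num) hj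

end Root

/-! ### §4 with `a = 1`: the reciprocal on `[1, 2)`, output binade `(1/2, 1]` (`e₂ = −1`) -/

section Reciprocal

variable {n : ℕ}

/-- The scaled reciprocal: `2^n · (1/x) = 2^(2n−1)/X` for `x = X·2^(1−n)`. [cite: BrisebarreMuller2007, §4] -/
private theorem inv_setup (hn : 1 ≤ n) {X : ℤ} (hX : X ∈ sigRange n) :
    0 < (X : ℝ) ∧ (X : ℝ) < 2 ^ n ∧
      scaled (fun x : ℝ => x⁻¹) n 0 (-1) X = (2 : ℝ) ^ (2 * n - 1) / X := by
  simp only [sigRange, Set.mem_Icc] at hX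
  obtain ⟨hXl, hXu⟩ := hX
  obtain ⟨m, rfl⟩ : ∃ m, n = m + 1 := ⟨n - 1, by omega⟩
  have hXl' : (2 : ℝ) ^ m ≤ X := by
    have : ((2 ^ (m + 1 - 1) : ℤ) : ℝ) ≤ X := by exact_mod_cast hXl
    simpa using this
  have hXu' : (X : ℝ) < 2 ^ (m + 1) := by
    have : (X : ℝ) ≤ ((2 ^ (m + 1) - 1 : ℤ) : ℝ) := by exact_mod_cast hXu
    push_cast at this; linarith
  have hXpos : (0 : ℝ) < X := lt_of_lt_of_le (by positivity) hXl'
  refine ⟨hXpos, hXu', ?_⟩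
  rw [scaled_def]
  have e1 : ((m + 1 : ℕ) : ℤ) - 1 - (-1) = ((m + 1 : ℕ) : ℤ) := by ring
  have e2 : (0 : ℤ) - ((m + 1 : ℕ) : ℤ) + 1 = -(m : ℤ) := by push_cast; ring
  have e3 : 2 * (m + 1) - 1 = (m + 1) + m := by omega
  rw [e1, e2, zpow_natCast, zpow_neg, zpow_natCast, e3, pow_add]
  field_simp
  ring

/-- **[BrisebarreMuller2007, §4.1] with `a = 1`, radix 2, directed roundings** ("μ(n) ≤ 2n"): for a
precision-`n` `x ∈ [1,2)` with `1/x` not a floating-point number and ANY integer `Y`,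
`|2^n·(1/x) − Y| = |2^(2n−1) − X·Y|/X ≥ 1/X > 2^(−n)`. [cite: BrisebarreMuller2007, §4.1] -/
theorem inv_hardness_dir (hn : 1 ≤ n) {X : ℤ} (hX : X ∈ sigRange n) (Y : ℤ)
    (hne : scaled (fun x : ℝ => x⁻¹) n 0 (-1) X ≠ Y) :
    (2 : ℝ) ^ (-(n : ℤ)) < |scaled (fun x : ℝ => x⁻¹) n 0 (-1) X - Y| := by
  obtain ⟨hXpos, hXu, hsc⟩ := inv_setup hn hX
  rw [hsc] at hne ⊢
  set M : ℤ := 2 ^ (2 * n - 1) - X * Y with hM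
  have hid : (2 : ℝ) ^ (2 * n - 1) / X - Y = (M : ℝ) / X := by
    rw [hM]; push_cast; field_simp
  have hMne : M ≠ 0 := by
    intro h0; apply hne; rw [← sub_eq_zero, hid, h0]; simp
  rw [hid, abs_div, abs_of_pos hXpos, zpow_neg, zpow_natCast]
  have h1 : (1 : ℝ) ≤ |(M : ℝ)| := by rw [← Int.cast_abs]; exact_mod_cast Int.one_le_abs hMne
  calc ((2 : ℝ) ^ n)⁻¹ < (X : ℝ)⁻¹ := by
        rw [inv_lt_inv₀ (by positivity) hXpos]; exact hXu
    _ = 1 / X := (one_div _).symm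
    _ ≤ |(M : ℝ)| / X := div_le_div_of_nonneg_right h1 hXpos.le

/-- **[BrisebarreMuller2007, §4.2] with `a = 1`, radix 2, rounding to nearest** ("μ(n) ≤ 2n + 1"): for a
precision-`n` `x ∈ [1,2)` and `Y ∈ ⟦2^(n−1), 2^n − 1⟧`, `|2^n·(1/x) − (Y + 1/2)| = |2^(2n) − X(2Y+1)|/(2X)
> 2^(−(n+1))` (the integer is non-zero because `2Y + 1 > 1` is odd). [cite: BrisebarreMuller2007, §4.2] -/
theorem inv_hardness_rn (hn : 1 ≤ n) {X Y : ℤ} (hX : X ∈ sigRange n)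
    (hY : Y ∈ Set.Icc (2 ^ (n - 1) : ℤ) (2 ^ n - 1)) :
    (2 : ℝ) ^ (-((n : ℤ) + 1)) < |scaled (fun x : ℝ => x⁻¹) n 0 (-1) X - (Y + 1 / 2)| := by
  obtain ⟨hXpos, hXu, hsc⟩ := inv_setup hn hX
  obtain ⟨k, hk1, hk2⟩ : ∃ k, 2 * n - 1 = k ∧ 2 * n = k + 1 := ⟨2 * n - 1, rfl, by omega⟩
  rw [hk1] at hsc
  rw [hsc]
  obtain ⟨hYl, -⟩ := hY
  have hY1 : 1 ≤ Y := le_trans (one_le_pow₀ (by norm_num)) hYl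
  set M : ℤ := 2 ^ (k + 1) - X * (2 * Y + 1) with hM
  have hid : (2 : ℝ) ^ k / X - (Y + 1 / 2) = (M : ℝ) / (2 * X) := by
    rw [hM]; push_cast; rw [pow_succ]; field_simp
  have hMne : M ≠ 0 := by
    intro h0
    have hdvd : (2 * Y + 1) ∣ (2 : ℤ) ^ (k + 1) := ⟨X, by linear_combination h0⟩
    have hcop : IsCoprime (2 * Y + 1) ((2 : ℤ) ^ (k + 1)) :=
      IsCoprime.pow_right ⟨1, -Y, by ring⟩
    have hunit : IsUnit (2 * Y + 1) := hcop.isUnit_of_dvd' (dvd_refl _) hdvd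
    rcases Int.isUnit_iff.1 hunit with h | h <;> omega
  rw [hid, abs_div, abs_of_pos (by positivity : (0 : ℝ) < 2 * X), zpow_neg,
    show ((n : ℤ) + 1) = ((n + 1 : ℕ) : ℤ) by push_cast; ring, zpow_natCast]
  have h1 : (1 : ℝ) ≤ |(M : ℝ)| := by rw [← Int.cast_abs]; exact_mod_cast Int.one_le_abs hMne
  calc ((2 : ℝ) ^ (n + 1))⁻¹ < (2 * (X : ℝ))⁻¹ := by
        rw [inv_lt_inv₀ (by positivity) (by positivity), pow_succ]; linarith
    _ = 1 / (2 * X) := (one_div _).symm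
    _ ≤ |(M : ℝ)| / (2 * X) := div_le_div_of_nonneg_right h1 (by positivity)

/-- Reciprocal, directed roundings, as BHMZ Problem 4.1: hardness to round `≤ n` on `[1,2)`.
[cite: BrisebarreMuller2007, §4.1] -/
theorem inv_hardnessToRoundDirLE (hn : 1 ≤ n) : HardnessToRoundDirLE (fun x : ℝ => x⁻¹) n 0 (-1) n := by
  intro X hX hexact Y _
  exact (inv_hardness_dir hn hX Y (fun h => hexact ⟨Y, h⟩)).le

/-- Reciprocal, rounding to nearest, as BHMZ Problem 4.2: hardness to round `≤ n + 1` on `[1,2)`.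
[cite: BrisebarreMuller2007, §4.2] -/
theorem inv_hardnessToRoundRNLE (hn : 1 ≤ n) :
    HardnessToRoundRNLE (fun x : ℝ => x⁻¹) n 0 (-1) ((n : ℤ) + 1) := by
  intro X hX _ Y hY
  exact (inv_hardness_rn hn hX hY).le

/-- binary64 reciprocal: no 53-bad case for directed roundings, no 54-bad case for rounding to nearest
(correct rounding of `1/x` from a double-width quotient, the classical fact).
[cite: BrisebarreMuller2007, §4] -/
theorem inv_binary64 :
    HardnessToRoundDirLE (fun x : ℝ => x⁻¹) 53 0 (-1) 53 ∧ HardnessToRoundRNLE (fun x : ℝ => x⁻¹) 53 0 (-1) 54 :=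
  ⟨inv_hardnessToRoundDirLE (by norm_num), by simpa using inv_hardnessToRoundRNLE (n := 53) (by norm_num)⟩

end Reciprocal

/-! ### §5.2 with `p = −1`, `q = 2`: the reciprocal square root on `[2^j, 2^(j+1))`, `j < 2`,
output binade `(1/2, 1]` (`e₂ = −1`)

§5.2 ("Case when p negative") runs the §5.1 argument for `x^(p/q)`, `p < 0`: `P(t) = t^q − x^p`,
"P(y) − P(x^(p/q)) = P′(c)(y − x^(p/q))", and "As we assumed y − x^(p/q) ≠ 0, the integer … is not equal to
zero". For `p = −1`, `q = 2`, `r = 2` (so `k = 0`, `x ∈ [1, 4)`, `y ∈ (1/2, 1]`, `j ∈ {0, 1}`), in the scaled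
units of BHMZ Problems 4.1/4.2 (`g = 2^n/√x`, `x = X·2^(j−n+1)`, so `g² = 2^(3n−1−j)/X`) and with the
algebraic identity `g² − Y² = (g − Y)(g + Y)` in place of the mean value theorem:
`g − Y = (2^(3n−1−j) − X·Y²)/(X(g + Y))` and `g − (Y + 1/2) = (2^(3n+1−j) − X(2Y+1)²)/(4X(g + Y + 1/2))`, the
numerators being NON-ZERO INTEGERS (the second unconditionally: `(2Y+1)² > 1` is odd), and
`X(g + Y) < 2^n·2^(n+1)`, `4X(g + Y + 1/2) < 2^(2n+3)`. The constants `2n+1`, `2n+3` are ours (the printed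
general exponent is not legible in our copy of §5.2.1); the argument is the paper's.
-/

section Rsqrt

variable {n j : ℕ}

/-- The scaled reciprocal square root: for `x = X·2^(j−n+1) ∈ [2^j, 2^(j+1))` (so `x ≥ 1`), `g = 2^n/√x`
satisfies `0 < g ≤ 2^n` and `g² = 2^(3n−1−j)/X`. [cite: BrisebarreMuller2007, §5.2] -/
private theorem rsqrt_setup (hn : 1 ≤ n) (hj : j < 2) {X : ℤ} (hX : X ∈ sigRange n) :
    0 < (X : ℝ) ∧ (X : ℝ) < 2 ^ n ∧ 0 < scaled (fun x : ℝ => 1 / Real.sqrt x) n j (-1) X ∧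
      scaled (fun x : ℝ => 1 / Real.sqrt x) n j (-1) X ≤ 2 ^ n ∧
      (scaled (fun x : ℝ => 1 / Real.sqrt x) n j (-1) X) ^ 2 = (2 : ℝ) ^ (3 * n - 1 - j) / X := by
  simp only [sigRange, Set.mem_Icc] at hX
  obtain ⟨hXl, hXu⟩ := hX
  obtain ⟨m, rfl⟩ : ∃ m, n = m + 1 := ⟨n - 1, by omega⟩
  have hXl' : (2 : ℝ) ^ m ≤ X := by
    have : ((2 ^ (m + 1 - 1) : ℤ) : ℝ) ≤ X := by exact_mod_cast hXl
    simpa using this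
  have hXu' : (X : ℝ) < 2 ^ (m + 1) := by
    have : (X : ℝ) ≤ ((2 ^ (m + 1) - 1 : ℤ) : ℝ) := by exact_mod_cast hXu
    push_cast at this; linarith
  have hXpos : (0 : ℝ) < X := lt_of_lt_of_le (by positivity) hXl'
  have ex : (X : ℝ) * (2 : ℝ) ^ ((j : ℤ) - ((m + 1 : ℕ) : ℤ) + 1) = (X : ℝ) * 2 ^ j / 2 ^ m := by
    have : ((j : ℤ) - ((m + 1 : ℕ) : ℤ) + 1) = (j : ℤ) - (m : ℤ) := by push_cast; ring
    rw [this, zpow_sub₀ (by norm_num), zpow_natCast, zpow_natCast, mul_div_assoc]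
  have hx1 : (1 : ℝ) ≤ (X : ℝ) * 2 ^ j / 2 ^ m := by
    rw [le_div_iff₀ (by positivity), one_mul]
    calc (2 : ℝ) ^ m ≤ X := hXl'
      _ = X * 2 ^ 0 := by simp
      _ ≤ X * 2 ^ j :=
          mul_le_mul_of_nonneg_left (pow_le_pow_right₀ (by norm_num) (Nat.zero_le j)) hXpos.le
  have hxpos : (0 : ℝ) < (X : ℝ) * 2 ^ j / 2 ^ m := by positivity
  have hsqrt1 : (1 : ℝ) ≤ Real.sqrt ((X : ℝ) * 2 ^ j / 2 ^ m) := Real.one_le_sqrt.mpr hx1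
  have hsqrtpos : (0 : ℝ) < Real.sqrt ((X : ℝ) * 2 ^ j / 2 ^ m) := lt_of_lt_of_le one_pos hsqrt1
  have hsc : scaled (fun x : ℝ => 1 / Real.sqrt x) (m + 1) j (-1) X =
      (2 : ℝ) ^ (m + 1) / Real.sqrt ((X : ℝ) * 2 ^ j / 2 ^ m) := by
    rw [scaled_def, ex]
    have e1 : ((m + 1 : ℕ) : ℤ) - 1 - (-1) = ((m + 1 : ℕ) : ℤ) := by ring
    rw [e1, zpow_natCast, mul_one_div]
  refine ⟨hXpos, hXu', ?_, ?_, ?_⟩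
  · rw [hsc]; positivity
  · rw [hsc, div_le_iff₀ hsqrtpos]
    calc (2 : ℝ) ^ (m + 1) = 2 ^ (m + 1) * 1 := (mul_one _).symm
      _ ≤ 2 ^ (m + 1) * Real.sqrt ((X : ℝ) * 2 ^ j / 2 ^ m) :=
          mul_le_mul_of_nonneg_left hsqrt1 (by positivity)
  · rw [hsc, div_pow, Real.sq_sqrt hxpos.le]
    interval_cases j
    · rw [show 3 * (m + 1) - 1 - 0 = 3 * m + 2 by omega]
      field_simp
      ring
    · rw [show 3 * (m + 1) - 1 - 1 = 3 * m + 1 by omega]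
      field_simp
      ring

/-- **Reciprocal square root, radix 2, directed roundings** (the §5.2.1 argument with `p = −1`, `q = 2`,
constants ours): for a precision-`n` `x ∈ [2^j, 2^(j+1))`, `j < 2`, with `1/√x` not a floating-point number,
and any `Y ∈ ⟦2^(n−1), 2^n⟧`, `|2^n/√x − Y| = |2^(3n−1−j) − X·Y²|/(X(2^n/√x + Y)) > 2^(−(2n+1))`.
[cite: BrisebarreMuller2007, §5.2.1] -/
theorem rsqrt_hardness_dir (hn : 1 ≤ n) (hj : j < 2) {X Y : ℤ} (hX : X ∈ sigRange n)
    (hY : Y ∈ Set.Icc (2 ^ (n - 1) : ℤ) (2 ^ n))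
    (hne : scaled (fun x : ℝ => 1 / Real.sqrt x) n j (-1) X ≠ Y) :
    (2 : ℝ) ^ (-(2 * (n : ℤ) + 1)) < |scaled (fun x : ℝ => 1 / Real.sqrt x) n j (-1) X - Y| := by
  obtain ⟨hXpos, hXu, hgpos, hgle, hg2⟩ := rsqrt_setup hn hj hX
  obtain ⟨g, hg⟩ : ∃ g, scaled (fun x : ℝ => 1 / Real.sqrt x) n j (-1) X = g := ⟨_, rfl⟩
  rw [hg] at hgpos hgle hg2 hne ⊢
  obtain ⟨hYl, hYu⟩ := hY
  have hY1 : (1 : ℝ) ≤ Y := by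
    have : (1 : ℤ) ≤ Y := le_trans (one_le_pow₀ (by norm_num)) hYl
    exact_mod_cast this
  have hYu' : (Y : ℝ) ≤ 2 ^ n := by exact_mod_cast hYu
  have hsum : 0 < g + Y := by linarith
  have hden : 0 < (X : ℝ) * (g + Y) := mul_pos hXpos hsum
  set M : ℤ := 2 ^ (3 * n - 1 - j) - X * Y ^ 2 with hM
  have hid : g - Y = (M : ℝ) / (X * (g + Y)) := by
    rw [hM, eq_div_iff hden.ne']
    push_cast
    have e : (g - Y) * (X * (g + Y)) = X * g ^ 2 - X * Y ^ 2 := by ring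
    rw [e, hg2, mul_div_cancel₀ _ hXpos.ne']
  have hMne : M ≠ 0 := by
    intro h0
    apply hne
    have : g - Y = 0 := by rw [hid, h0]; simp
    linarith
  have h1 : (1 : ℝ) ≤ |(M : ℝ)| := by rw [← Int.cast_abs]; exact_mod_cast Int.one_le_abs hMne
  have hden_lt : (X : ℝ) * (g + Y) < 2 ^ (2 * n + 1) := by
    calc (X : ℝ) * (g + Y) < 2 ^ n * (g + Y) := mul_lt_mul_of_pos_right hXu hsum
      _ ≤ 2 ^ n * (2 ^ n + 2 ^ n) := mul_le_mul_of_nonneg_left (by linarith) (by positivity)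
      _ = 2 ^ (2 * n + 1) := by ring
  rw [hid, abs_div, abs_of_pos hden,
    show (-(2 * (n : ℤ) + 1)) = -((2 * n + 1 : ℕ) : ℤ) by push_cast; ring, zpow_neg, zpow_natCast]
  calc ((2 : ℝ) ^ (2 * n + 1))⁻¹ < ((X : ℝ) * (g + Y))⁻¹ := by
        rw [inv_lt_inv₀ (by positivity) hden]; exact hden_lt
    _ = 1 / (X * (g + Y)) := (one_div _).symm
    _ ≤ |(M : ℝ)| / (X * (g + Y)) := div_le_div_of_nonneg_right h1 hden.le

/-- **Reciprocal square root, radix 2, rounding to nearest** (the §5.2.2 argument with `p = −1`, `q = 2`,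
constants ours): for a precision-`n` `x ∈ [2^j, 2^(j+1))`, `j < 2`, and `Y ∈ ⟦2^(n−1), 2^n − 1⟧`,
`|2^n/√x − (Y + 1/2)| = |2^(3n+1−j) − X(2Y+1)²|/(4X(2^n/√x + Y + 1/2)) > 2^(−(2n+3))`; NO exactness
hypothesis is needed — the integer is non-zero because `(2Y+1)²` is odd and `> 1`, i.e. `1/√x` is never a
rounding-to-nearest midpoint. [cite: BrisebarreMuller2007, §5.2.2] -/
theorem rsqrt_hardness_rn (hn : 1 ≤ n) (hj : j < 2) {X Y : ℤ} (hX : X ∈ sigRange n)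
    (hY : Y ∈ Set.Icc (2 ^ (n - 1) : ℤ) (2 ^ n - 1)) :
    (2 : ℝ) ^ (-(2 * (n : ℤ) + 3)) <
      |scaled (fun x : ℝ => 1 / Real.sqrt x) n j (-1) X - (Y + 1 / 2)| := by
  obtain ⟨hXpos, hXu, hgpos, hgle, hg2⟩ := rsqrt_setup hn hj hX
  obtain ⟨g, hg⟩ : ∃ g, scaled (fun x : ℝ => 1 / Real.sqrt x) n j (-1) X = g := ⟨_, rfl⟩
  rw [hg] at hgpos hgle hg2 ⊢
  obtain ⟨hYl, hYu⟩ := hY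
  have hY1 : 1 ≤ Y := le_trans (one_le_pow₀ (by norm_num)) hYl
  have hY1' : (1 : ℝ) ≤ Y := by exact_mod_cast hY1
  have hYu' : (Y : ℝ) ≤ 2 ^ n - 1 := by
    have : (Y : ℝ) ≤ ((2 ^ n - 1 : ℤ) : ℝ) := by exact_mod_cast hYu
    push_cast at this; exact this
  obtain ⟨k, hk1, hk2⟩ : ∃ k, 3 * n - 1 - j = k ∧ 3 * n + 1 - j = k + 2 :=
    ⟨3 * n - 1 - j, rfl, by omega⟩
  rw [hk1] at hg2
  have hsum : 0 < g + (Y + 1 / 2) := by linarith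
  have hden : 0 < 4 * (X : ℝ) * (g + (Y + 1 / 2)) := by positivity
  set M : ℤ := 2 ^ (k + 2) - X * (2 * Y + 1) ^ 2 with hM
  have hid : g - (Y + 1 / 2) = (M : ℝ) / (4 * X * (g + (Y + 1 / 2))) := by
    rw [hM, eq_div_iff hden.ne']
    push_cast
    have e : (g - (Y + 1 / 2)) * (4 * X * (g + (Y + 1 / 2))) = 4 * (X * g ^ 2) - X * (2 * Y + 1) ^ 2 := by
      ring
    rw [e, hg2, mul_div_cancel₀ _ hXpos.ne', pow_add]
    ring
  have hMne : M ≠ 0 := by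
    intro h0
    have hdvd : (2 * Y + 1) ∣ (2 : ℤ) ^ (k + 2) := ⟨X * (2 * Y + 1), by linear_combination h0⟩
    have hcop : IsCoprime (2 * Y + 1) ((2 : ℤ) ^ (k + 2)) :=
      IsCoprime.pow_right ⟨1, -Y, by ring⟩
    have hunit : IsUnit (2 * Y + 1) := hcop.isUnit_of_dvd' (dvd_refl _) hdvd
    rcases Int.isUnit_iff.1 hunit with h | h <;> omega
  have h1 : (1 : ℝ) ≤ |(M : ℝ)| := by rw [← Int.cast_abs]; exact_mod_cast Int.one_le_abs hMne
  have hden_lt : 4 * (X : ℝ) * (g + (Y + 1 / 2)) < 2 ^ (2 * n + 3) := by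
    calc 4 * (X : ℝ) * (g + (Y + 1 / 2)) < 4 * 2 ^ n * (g + (Y + 1 / 2)) :=
          mul_lt_mul_of_pos_right (mul_lt_mul_of_pos_left hXu (by norm_num)) hsum
      _ ≤ 4 * 2 ^ n * 2 ^ (n + 1) :=
          mul_le_mul_of_nonneg_left (by rw [pow_succ]; linarith) (by positivity)
      _ = 2 ^ (2 * n + 3) := by ring
  rw [hid, abs_div, abs_of_pos hden,
    show (-(2 * (n : ℤ) + 3)) = -((2 * n + 3 : ℕ) : ℤ) by push_cast; ring, zpow_neg, zpow_natCast]
  calc ((2 : ℝ) ^ (2 * n + 3))⁻¹ < (4 * (X : ℝ) * (g + (Y + 1 / 2)))⁻¹ := by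
        rw [inv_lt_inv₀ (by positivity) hden]; exact hden_lt
    _ = 1 / (4 * X * (g + (Y + 1 / 2))) := (one_div _).symm
    _ ≤ |(M : ℝ)| / (4 * X * (g + (Y + 1 / 2))) := div_le_div_of_nonneg_right h1 hden.le

/-- Reciprocal square root, directed roundings, as BHMZ Problem 4.1: hardness to round `≤ 2n + 1` on each
of `[1,2)`, `[2,4)` (output binade `(1/2, 1]`). [cite: BrisebarreMuller2007, §5.2.1] -/
theorem rsqrt_hardnessToRoundDirLE (hn : 1 ≤ n) (hj : j < 2) :
    HardnessToRoundDirLE (fun x : ℝ => 1 / Real.sqrt x) n j (-1) (2 * (n : ℤ) + 1) := by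
  intro X hX hexact Y hY
  exact (rsqrt_hardness_dir hn hj hX hY (fun h => hexact ⟨Y, h⟩)).le

/-- Reciprocal square root, rounding to nearest, as BHMZ Problem 4.2: hardness to round `≤ 2n + 3`.
[cite: BrisebarreMuller2007, §5.2.2] -/
theorem rsqrt_hardnessToRoundRNLE (hn : 1 ≤ n) (hj : j < 2) :
    HardnessToRoundRNLE (fun x : ℝ => 1 / Real.sqrt x) n j (-1) (2 * (n : ℤ) + 3) := by
  intro X hX _ Y hY
  exact (rsqrt_hardness_rn hn hj hX hY).le

/-- binary64 reciprocal square root (`1/√x`, the cell's `rsqrt`): on both input binades, a non-exact value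
is never within `2^(−107)` ulp-units of a floating-point number (directed), and no value is within
`2^(−109)` of a midpoint (nearest). [cite: BrisebarreMuller2007, §5.2] -/
theorem rsqrt_binary64 (hj : j < 2) :
    HardnessToRoundDirLE (fun x : ℝ => 1 / Real.sqrt x) 53 j (-1) 107 ∧
      HardnessToRoundRNLE (fun x : ℝ => 1 / Real.sqrt x) 53 j (-1) 109 := by
  refine ⟨?_, ?_⟩
  · have h := rsqrt_hardnessToRoundDirLE (n := 53) (by norm_num) hj
    have e : (2 * ((53 : ℕ) : ℤ) + 1 : ℤ) = 107 := by norm_num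
    rw [e] at h
    exact h
  · have h := rsqrt_hardnessToRoundRNLE (n := 53) (by norm_num) hj
    have e : (2 * ((53 : ℕ) : ℤ) + 3 : ℤ) = 109 := by norm_num
    rw [e] at h
    exact h

end Rsqrt

/-! ### All input binades: the exponent periodicity of `x^(1/q)` and `1/√x`

The statements above sit on the input binades `[2^j, 2^(j+1))`, `j < q` (resp. `j < 2`), as in the paper
("x ∈ [1, r^q)", §5.1; "x ∈ [1, r^(q/|p|))", §5.2). Every other binade reduces to these EXACTLY: multiplying
the input by `2^(qk)` multiplies `x^(1/q)` by `2^k` (resp. multiplying by `4^k` multiplies `1/√x` by `2^(−k)`),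
and in the scaled units of BHMZ Problems 4.1/4.2 — where the input exponent `e₁` and the output exponent `e₂`
enter only through `g(X) = 2^(p−1−e₂)·f(X·2^(e₁−p+1))` — the scaled function is then literally the same.
[cite: BrisebarreEtAl2025, Problem 4.1] for the shape of `g`; the reduction is elementary algebra, recorded
here so that the binary64 statements quantify over EVERY input binade `e₁ = e`.
-/

section AllBinades

/-- The TMD statement for directed roundings depends on `(f, e₁, e₂)` only through the scaled function on
the significand range. [cite: BrisebarreEtAl2025, Problem 4.1] -/
theorem hardnessToRoundDirLE_congr {f f' : ℝ → ℝ} {p : ℕ} {e₁ e₂ e₁' e₂' μ : ℤ}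
    (h : ∀ X ∈ sigRange p, scaled f p e₁ e₂ X = scaled f' p e₁' e₂' X) :
    HardnessToRoundDirLE f p e₁ e₂ μ ↔ HardnessToRoundDirLE f' p e₁' e₂' μ := by
  unfold HardnessToRoundDirLE
  refine forall₂_congr fun X hX => ?_
  rw [h X hX]

/-- The TMD statement for rounding to nearest depends on `(f, e₁, e₂)` only through the scaled function on
the significand range. [cite: BrisebarreEtAl2025, Problem 4.2] -/
theorem hardnessToRoundRNLE_congr {f f' : ℝ → ℝ} {p : ℕ} {e₁ e₂ e₁' e₂' μ : ℤ}
    (h : ∀ X ∈ sigRange p, scaled f p e₁ e₂ X = scaled f' p e₁' e₂' X) :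
    HardnessToRoundRNLE f p e₁ e₂ μ ↔ HardnessToRoundRNLE f' p e₁' e₂' μ := by
  unfold HardnessToRoundRNLE
  refine forall₂_congr fun X hX => ?_
  rw [h X hX]

/-- Exponent periodicity of the `q`-th root in scaled units: input binade `j + qk` with output binade `k`
has the same scaled function as input binade `j` with output binade `0` (`(y·2^(qk))^(1/q) = y^(1/q)·2^k`).
[cite: BrisebarreMuller2007, §5.1] -/
theorem scaled_rpow_inv_periodic {q : ℕ} (hq : 1 ≤ q) (n : ℕ) (j k : ℤ) {X : ℤ} (hX : 0 ≤ X) :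
    scaled (fun x : ℝ => x ^ ((q : ℝ)⁻¹)) n (j + (q : ℤ) * k) k X =
      scaled (fun x : ℝ => x ^ ((q : ℝ)⁻¹)) n j 0 X := by
  simp only [scaled_def]
  have hq0 : (q : ℝ) ≠ 0 := by exact_mod_cast (show q ≠ 0 by omega)
  have hX' : (0 : ℝ) ≤ (X : ℝ) := by exact_mod_cast hX
  have hroot : ((2 : ℝ) ^ ((q : ℤ) * k)) ^ ((q : ℝ)⁻¹) = (2 : ℝ) ^ k := by
    rw [← Real.rpow_intCast, ← Real.rpow_mul (by norm_num : (0 : ℝ) ≤ 2), ← Real.rpow_intCast]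
    congr 1
    push_cast
    rw [mul_comm (q : ℝ) (k : ℝ), mul_inv_cancel_right₀ hq0]
  have harg : (X : ℝ) * (2 : ℝ) ^ (j + (q : ℤ) * k - (n : ℤ) + 1) =
      (X : ℝ) * (2 : ℝ) ^ (j - (n : ℤ) + 1) * (2 : ℝ) ^ ((q : ℤ) * k) := by
    rw [show j + (q : ℤ) * k - (n : ℤ) + 1 = (j - (n : ℤ) + 1) + (q : ℤ) * k by ring,
      zpow_add₀ (two_ne_zero : (2 : ℝ) ≠ 0) (j - (n : ℤ) + 1) ((q : ℤ) * k)]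
    ring
  have hexp : (2 : ℝ) ^ ((n : ℤ) - 1 - k) * (2 : ℝ) ^ k = (2 : ℝ) ^ ((n : ℤ) - 1 - 0) := by
    rw [← zpow_add₀ (two_ne_zero : (2 : ℝ) ≠ 0)]
    congr 1
    ring
  have hy : (0 : ℝ) ≤ (X : ℝ) * (2 : ℝ) ^ (j - (n : ℤ) + 1) :=
    mul_nonneg hX' (zpow_pos (by norm_num : (0 : ℝ) < 2) _).le
  rw [harg, Real.mul_rpow hy (zpow_pos (by norm_num : (0 : ℝ) < 2) _).le, hroot, ← hexp]
  ring

/-- Exponent periodicity of the reciprocal square root in scaled units: input binade `j + 2k` with output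
binade `−1 − k` has the same scaled function as input binade `j` with output binade `−1`
(`1/√(y·4^k) = 2^(−k)/√y`). [cite: BrisebarreMuller2007, §5.2] -/
theorem scaled_rsqrt_periodic (n : ℕ) (j k X : ℤ) :
    scaled (fun x : ℝ => 1 / Real.sqrt x) n (j + 2 * k) (-1 - k) X =
      scaled (fun x : ℝ => 1 / Real.sqrt x) n j (-1) X := by
  simp only [scaled_def]
  have h2k : (0 : ℝ) < (2 : ℝ) ^ k := zpow_pos (by norm_num) k
  have harg : (X : ℝ) * (2 : ℝ) ^ (j + 2 * k - (n : ℤ) + 1) =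
      (X : ℝ) * (2 : ℝ) ^ (j - (n : ℤ) + 1) * ((2 : ℝ) ^ k) ^ 2 := by
    rw [show j + 2 * k - (n : ℤ) + 1 = (j - (n : ℤ) + 1) + (k + k) by ring,
      zpow_add₀ (two_ne_zero : (2 : ℝ) ≠ 0) (j - (n : ℤ) + 1) (k + k),
      zpow_add₀ (two_ne_zero : (2 : ℝ) ≠ 0) k k, pow_two]
    ring
  have hexp : (2 : ℝ) ^ ((n : ℤ) - 1 - (-1 - k)) = (2 : ℝ) ^ ((n : ℤ) - 1 - (-1)) * (2 : ℝ) ^ k := by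
    rw [← zpow_add₀ (two_ne_zero : (2 : ℝ) ≠ 0)]
    congr 1
    ring
  rw [harg, hexp, Real.sqrt_mul' _ (sq_nonneg _), Real.sqrt_sq h2k.le, one_div, one_div, mul_inv]
  calc (2 : ℝ) ^ ((n : ℤ) - 1 - (-1)) * 2 ^ k *
        ((Real.sqrt ((X : ℝ) * 2 ^ (j - (n : ℤ) + 1)))⁻¹ * (2 ^ k)⁻¹)
        = (2 : ℝ) ^ ((n : ℤ) - 1 - (-1)) * (Real.sqrt ((X : ℝ) * 2 ^ (j - (n : ℤ) + 1)))⁻¹ *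
          (2 ^ k * (2 ^ k)⁻¹) := by ring
    _ = (2 : ℝ) ^ ((n : ℤ) - 1 - (-1)) * (Real.sqrt ((X : ℝ) * 2 ^ (j - (n : ℤ) + 1)))⁻¹ := by
          rw [mul_inv_cancel₀ h2k.ne', mul_one]

variable {n : ℕ}

/-- The `q`-th root on EVERY input binade `e` (output binade `⌊e/q⌋`), directed roundings:
`μ = (q−1)n + c`, `q ≤ 2^c`. [cite: BrisebarreMuller2007, §5.1.1] -/
theorem rpow_inv_hardnessToRoundDirLE_all {q : ℕ} (hq : 1 ≤ q) (hn : 1 ≤ n) {c : ℕ} (hc : q ≤ 2 ^ c)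
    (e : ℤ) :
    HardnessToRoundDirLE (fun x : ℝ => x ^ ((q : ℝ)⁻¹)) n e (e / q) (((q - 1) * n + c : ℕ) : ℤ) := by
  have hq0 : (0 : ℤ) < q := by exact_mod_cast (show 0 < q by omega)
  obtain ⟨j, hjq, hje⟩ : ∃ j : ℕ, j < q ∧ (j : ℤ) + (q : ℤ) * (e / q) = e :=
    ⟨(e % q).toNat, by
      have h1 := Int.emod_nonneg e hq0.ne'
      have h2 := Int.emod_lt_of_pos e hq0
      omega, by
      have h1 := Int.emod_nonneg e hq0.ne'
      have h3 := Int.emod_add_mul_ediv e q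
      rw [Int.toNat_of_nonneg h1]
      linarith⟩
  have key : ∀ X ∈ sigRange n, scaled (fun x : ℝ => x ^ ((q : ℝ)⁻¹)) n e (e / q) X =
      scaled (fun x : ℝ => x ^ ((q : ℝ)⁻¹)) n j 0 X := fun X hX => by
    have hX0 : (0 : ℤ) ≤ X := le_trans (by positivity) hX.1
    have h := scaled_rpow_inv_periodic hq n (j : ℤ) (e / q) hX0
    rwa [hje] at h
  exact (hardnessToRoundDirLE_congr key).2 (rpow_inv_hardnessToRoundDirLE hq hn hjq hc)

/-- The `q`-th root on every input binade, rounding to nearest: `μ = (q−1)n + q + c`.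
[cite: BrisebarreMuller2007, §5.1.2] -/
theorem rpow_inv_hardnessToRoundRNLE_all {q : ℕ} (hq : 1 ≤ q) (hn : 1 ≤ n) {c : ℕ} (hc : q ≤ 2 ^ c)
    (e : ℤ) :
    HardnessToRoundRNLE (fun x : ℝ => x ^ ((q : ℝ)⁻¹)) n e (e / q) (((q - 1) * n + q + c : ℕ) : ℤ) := by
  have hq0 : (0 : ℤ) < q := by exact_mod_cast (show 0 < q by omega)
  obtain ⟨j, hjq, hje⟩ : ∃ j : ℕ, j < q ∧ (j : ℤ) + (q : ℤ) * (e / q) = e :=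
    ⟨(e % q).toNat, by
      have h1 := Int.emod_nonneg e hq0.ne'
      have h2 := Int.emod_lt_of_pos e hq0
      omega, by
      have h1 := Int.emod_nonneg e hq0.ne'
      have h3 := Int.emod_add_mul_ediv e q
      rw [Int.toNat_of_nonneg h1]
      linarith⟩
  have key : ∀ X ∈ sigRange n, scaled (fun x : ℝ => x ^ ((q : ℝ)⁻¹)) n e (e / q) X =
      scaled (fun x : ℝ => x ^ ((q : ℝ)⁻¹)) n j 0 X := fun X hX => by
    have hX0 : (0 : ℤ) ≤ X := le_trans (by positivity) hX.1
    have h := scaled_rpow_inv_periodic hq n (j : ℤ) (e / q) hX0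
    rwa [hje] at h
  exact (hardnessToRoundRNLE_congr key).2 (rpow_inv_hardnessToRoundRNLE hq hn hjq hc)

/-- binary64 cube root on EVERY input binade `e` (output binade `⌊e/3⌋`): no 108-bad directed case unless
exact, no 111-bad round-to-nearest case. [cite: BrisebarreMuller2007, §5.1] -/
theorem cbrt_binary64_all (e : ℤ) :
    HardnessToRoundDirLE (fun x : ℝ => x ^ ((3 : ℝ)⁻¹)) 53 e (e / 3) 108 ∧
      HardnessToRoundRNLE (fun x : ℝ => x ^ ((3 : ℝ)⁻¹)) 53 e (e / 3) 111 := by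
  have h1 := rpow_inv_hardnessToRoundDirLE_all (q := 3) (by norm_num) (n := 53) (by norm_num)
    (c := 2) (by norm_num) e
  have h2 := rpow_inv_hardnessToRoundRNLE_all (q := 3) (by norm_num) (n := 53) (by norm_num)
    (c := 2) (by norm_num) e
  norm_num at h1 h2 ⊢
  exact ⟨h1, h2⟩

/-- The reciprocal square root on EVERY input binade `e` (output binade `−1 − ⌊e/2⌋`), directed roundings:
`μ = 2n + 1`. [cite: BrisebarreMuller2007, §5.2.1] -/
theorem rsqrt_hardnessToRoundDirLE_all (hn : 1 ≤ n) (e : ℤ) :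
    HardnessToRoundDirLE (fun x : ℝ => 1 / Real.sqrt x) n e (-1 - e / 2) (2 * (n : ℤ) + 1) := by
  obtain ⟨j, hj2, hje⟩ : ∃ j : ℕ, j < 2 ∧ (j : ℤ) + 2 * (e / 2) = e :=
    ⟨(e % 2).toNat, by omega, by omega⟩
  have key : ∀ X ∈ sigRange n, scaled (fun x : ℝ => 1 / Real.sqrt x) n e (-1 - e / 2) X =
      scaled (fun x : ℝ => 1 / Real.sqrt x) n j (-1) X := fun X _ => by
    have h := scaled_rsqrt_periodic n (j : ℤ) (e / 2) X
    rwa [hje] at h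
  exact (hardnessToRoundDirLE_congr key).2 (rsqrt_hardnessToRoundDirLE hn hj2)

/-- The reciprocal square root on every input binade, rounding to nearest: `μ = 2n + 3`.
[cite: BrisebarreMuller2007, §5.2.2] -/
theorem rsqrt_hardnessToRoundRNLE_all (hn : 1 ≤ n) (e : ℤ) :
    HardnessToRoundRNLE (fun x : ℝ => 1 / Real.sqrt x) n e (-1 - e / 2) (2 * (n : ℤ) + 3) := by
  obtain ⟨j, hj2, hje⟩ : ∃ j : ℕ, j < 2 ∧ (j : ℤ) + 2 * (e / 2) = e :=
    ⟨(e % 2).toNat, by omega, by omega⟩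
  have key : ∀ X ∈ sigRange n, scaled (fun x : ℝ => 1 / Real.sqrt x) n e (-1 - e / 2) X =
      scaled (fun x : ℝ => 1 / Real.sqrt x) n j (-1) X := fun X _ => by
    have h := scaled_rsqrt_periodic n (j : ℤ) (e / 2) X
    rwa [hje] at h
  exact (hardnessToRoundRNLE_congr key).2 (rsqrt_hardnessToRoundRNLE hn hj2)

/-- binary64 reciprocal square root on EVERY input binade `e` (this covers every positive binary64 input,
subnormals included, as precision-53 inputs of their binade): no 107-bad directed case unless exact, no
109-bad round-to-nearest case. [cite: BrisebarreMuller2007, §5.2] -/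
theorem rsqrt_binary64_all (e : ℤ) :
    HardnessToRoundDirLE (fun x : ℝ => 1 / Real.sqrt x) 53 e (-1 - e / 2) 107 ∧
      HardnessToRoundRNLE (fun x : ℝ => 1 / Real.sqrt x) 53 e (-1 - e / 2) 109 := by
  refine ⟨?_, ?_⟩
  · have h := rsqrt_hardnessToRoundDirLE_all (n := 53) (by norm_num) e
    have e1 : (2 * ((53 : ℕ) : ℤ) + 1 : ℤ) = 107 := by norm_num
    rw [e1] at h
    exact h
  · have h := rsqrt_hardnessToRoundRNLE_all (n := 53) (by norm_num) e
    have e1 : (2 * ((53 : ℕ) : ℤ) + 3 : ℤ) = 109 := by norm_num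
    rw [e1] at h
    exact h

end AllBinades

end Literature.ComputerArithmetic.BrisebarreMuller2007
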